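import Summits.ABC.ABC.Theorems.SomeWindowSaving.Negative.TwistEdges

/-!
# The lower law in windows with small upper ratio `σ` (crux `TwistAmplification.SomeWindowSaving`)

Negative-side theorem for the crux `TwistAmplification.SomeWindowSaving` (stmt-ABC-1976), cdisprove
gen 3.  The landed lower law `not_windowSaving_below_law` (`Negative/LowerLaw.lean`) needs `σ > 12`
only because membership of the twisted Frey family `twistFamily p d` in the window uses the crude
conductor lower bound `p d² ∣ N` (the radical of `4p² − 1` is not controlled pointwise), so the upper
edge `M⁺ ≤ N^σ` was discharged by `2²⁴ p¹² ≤ p^σ`.  Here the upper edge is carried as the honest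
inequality `2²⁴ p¹² d⁶ ≤ (p d²)^σ`, i.e. `2²⁴ p^{12−σ} ≤ d^{2σ−6}` (`Negative/TwistEdges.lean`): along
the counting diagonal `p ≍ t^{2κ−6}`, `d ≍ t^{12−3κ}` it holds for large `t` exactly when
`κ (2σ + 3) < 9σ`.  Results:

* `not_windowSaving_below_law_of_sigma_le_twelve`: for `3 < σ ≤ 12`, `3 < κ`, `κ(2σ+3) < 9σ`
  (which forces `κ < 4`) there is no saving `δ < 1 − κ/6` in the window `[κ, σ]`;
* `not_windowSaving_below_law'`: the same for every `σ > 3` (cases `σ ≤ 12` / the landed `σ > 12`);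
* `no_witness_of_sigma_le_six`: **a witness of the crux with `σ ≤ 6` must have
  `κ ≥ 9σ/(2σ+3)`** — for `σ ≤ 6` the crux's threshold `(σ−κ)/(2σ−6)` is at most the law `1 − κ/6`
  (the margin `(κ−3)(σ−6)/(3(2σ−6))` is `≤ 0`), so below `9σ/(2σ+3)` the twisted Frey family of
  `1 + (4p²−1) = 4p²` alone defeats every admissible `δ` (e.g. `σ = 6 ⇒ κ ≥ 3.6`,
  `σ = 5 ⇒ κ ≥ 45/13`, `σ = 4 ⇒ κ ≥ 36/11`).

Reading for provers: every line on file (inert box, polynomial degree) produces `σ ≥ 6`; this file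
shows that the small-`σ` corner of the `∃` is not a cheaper place to look.
-/

noncomputable section

open UniqueFactorizationMonoid IsDedekindDomain Real WeierstrassCurve Rat.HeightOneSpectrum
open Literature.NumberTheory.EllipticCurves

namespace Summit.ABC.ABC.Theorems.SomeWindowSaving.Negative

section SmallSigma

open Filter

set_option maxHeartbeats 2000000 in
/-- **Lower law for `3 < σ ≤ 12` (unconditional) — refuted strengthening.**  For `3 < σ ≤ 12`,
`3 < κ` and `κ (2σ + 3) < 9σ` (which forces `κ < 4`) there is NO saving below the law `1 − κ/6`:
`¬ ∃ κ σ δ C, 3 < κ ∧ 3 < σ ≤ 12 ∧ κ(2σ+3) < 9σ ∧ δ < 1 − κ/6 ∧ ∀ X ≥ 1, T⁺_[κ,σ](X) ≤ C X^δ`.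
Same prime-pair twist count as `not_windowSaving_below_law` (`p ∈ (t^α, 8t^α]`,
`d ∈ (c_D t^β/8, c_D t^β]`, `α = 2κ − 6`, `β = 12 − 3κ`, `X ≍ t⁶`, `≫ t^{6−κ}/log² t` members); the
upper edge `2²⁴ p^{12−σ} ≤ d^{2σ−6}` holds on these ranges for large `t` because
`β(2σ−6) − α(12−σ) = 2(9σ − κ(2σ+3)) > 0`. -/
theorem not_windowSaving_below_law_of_sigma_le_twelve :
    ¬ ∃ κ σ δ C : ℝ, 3 < κ ∧ 3 < σ ∧ σ ≤ 12 ∧ κ * (2 * σ + 3) < 9 * σ ∧ δ < 1 - κ / 6 ∧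
        ∀ X : ℝ, 1 ≤ X → (windowCount κ σ X : ℝ) ≤ C * X ^ δ := by
  rintro ⟨κ, σ, δ, C, hκ3, hσ3, hσ12, hκσ, hδ, hcount⟩
  have hκ4 : κ < 4 := by nlinarith
  have hσ0 : (0 : ℝ) ≤ σ := by linarith
  obtain ⟨Y₀, hY₀64, hsupply⟩ := prime_supply
  -- exponents
  set α : ℝ := 2 * κ - 6 with hα
  set β : ℝ := 12 - 3 * κ with hβ
  have hα0 : 0 < α := by rw [hα]; linarith
  have hβ0 : 0 < β := by rw [hβ]; linarith
  have hαβ : α + β = 6 - κ := by rw [hα, hβ]; ring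
  have h32 : 3 * α + 2 * β = 6 := by rw [hα, hβ]; ring
  -- the constant `c_D` with `c_D ^ α = 2 ^ (23 − 13κ)`
  set cD : ℝ := (2 : ℝ) ^ ((23 - 13 * κ) / α) with hcD
  have hcD0 : 0 < cD := Real.rpow_pos_of_pos (by norm_num) _
  have hcDα : cD ^ α = (2 : ℝ) ^ (23 - 13 * κ) := by
    rw [hcD, ← Real.rpow_mul (by norm_num), div_mul_cancel₀ _ hα0.ne']
  -- upper-edge exponents (NEW w.r.t. `not_windowSaving_below_law`)
  set s : ℝ := 12 - σ with hs
  set r : ℝ := 2 * σ - 6 with hr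
  have hs0 : 0 ≤ s := by rw [hs]; linarith
  have hr0 : 0 < r := by rw [hr]; linarith
  set γ : ℝ := β * r - α * s with hγ
  have hγ0 : 0 < γ := by
    have e : γ = 2 * (9 * σ - κ * (2 * σ + 3)) := by rw [hγ, hα, hβ, hr, hs]; ring
    rw [e]; linarith
  set A : ℝ := (2 : ℝ) ^ 24 * (8 : ℝ) ^ s with hA
  set B : ℝ := (cD / 8) ^ r with hB
  have hA0 : 0 < A := by positivity
  have hB0 : 0 < B := Real.rpow_pos_of_pos (by positivity) _
  -- the number of excluded twisting primes per `p`
  set E : ℕ := ⌊4 * α / β⌋₊ + 1 with hE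
  have hE1 : 1 ≤ E := by rw [hE]; omega
  have hEβ : 4 * α < β * E := by
    have : 4 * α / β < E := by rw [hE]; push_cast; exact Nat.lt_floor_add_one _
    rw [div_lt_iff₀ hβ0] at this
    linarith
  -- the saving exponent, made nonnegative
  set δ' : ℝ := max δ 0 with hδ'
  have hδ'0 : 0 ≤ δ' := le_max_right _ _
  have hδ'lt : 6 * δ' < 6 - κ := by
    rcases le_or_gt δ 0 with h | h
    · rw [hδ', max_eq_right h]; linarith
    · rw [hδ', max_eq_left h.le]; linarith
  set η : ℝ := 6 - κ - 6 * δ' with hη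
  have hη0 : 0 < η := by rw [hη]; linarith
  set C₂ : ℝ := max C 0 * ((2 : ℝ) ^ 22 * cD ^ 2) ^ δ' with hC₂
  have hC₂0 : 0 ≤ C₂ := by positivity
  -- `log t ≤ c₁ t^{η/2}` eventually, with `c₁` small; `log t ≤ c₂ t^β` eventually
  set K : ℝ := 32 * (α + 1) * (β + 1) * (C₂ + 1) with hK
  have hK0 : 0 < K := by positivity
  set c₁ : ℝ := min 1 (cD / K) with hc₁
  have hc₁0 : 0 < c₁ := lt_min one_pos (div_pos hcD0 hK0)
  have hc₁1 : c₁ ≤ 1 := min_le_left _ _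
  have hc₁2 : c₁ ≤ cD / K := min_le_right _ _
  have hlog := (isLittleO_log_rpow_atTop (half_pos hη0)).bound hc₁0
  set c₂ : ℝ := cD / (16 * E * (β + 1)) with hc₂
  have hc₂0 : 0 < c₂ := by positivity
  have hlog' := (isLittleO_log_rpow_atTop hβ0).bound hc₂0
  -- all thresholds on the parameter `t`, eventually
  have hev : ∀ᶠ t : ℝ in atTop, ‖Real.log t‖ ≤ c₁ * ‖t ^ (η / 2)‖ ∧ ‖Real.log t‖ ≤ c₂ * ‖t ^ β‖ ∧
      8 ≤ t ∧ cD ≤ t ∧ ((4 : ℝ) ≤ t ^ α ∧ Y₀ ≤ 8 * t ^ α ∧ Y₀ ≤ cD * t ^ β ∧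
      (2 : ℝ) ^ 16 * (8 / cD) ^ E ≤ t ^ (β * E - 4 * α) ∧ A / B ≤ t ^ γ) := by
    refine hlog.and (hlog'.and ((eventually_ge_atTop 8).and ((eventually_ge_atTop cD).and ?_)))
    refine ((tendsto_rpow_atTop hα0).eventually_ge_atTop _).and
      ((((tendsto_rpow_atTop hα0).const_mul_atTop (by norm_num : (0 : ℝ) < 8)).eventually_ge_atTop _).and
      ((((tendsto_rpow_atTop hβ0).const_mul_atTop hcD0).eventually_ge_atTop _).and
      (((tendsto_rpow_atTop (by linarith : 0 < β * E - 4 * α)).eventually_ge_atTop _).and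
      ((tendsto_rpow_atTop hγ0).eventually_ge_atTop _))))
  obtain ⟨t, hlogbd, hlogbd', ht8, htcD, ht4, htY, htY', htE, htAB⟩ := hev.exists
  have ht1 : (1 : ℝ) ≤ t := by linarith
  have ht0 : (0 : ℝ) < t := by linarith
  -- the two prime ranges
  set y : ℝ := 8 * t ^ α with hy
  set y' : ℝ := cD * t ^ β with hy'
  have htα : (0 : ℝ) < t ^ α := Real.rpow_pos_of_pos ht0 _
  have htβ : (0 : ℝ) < t ^ β := Real.rpow_pos_of_pos ht0 _
  have hy64 : (64 : ℝ) ≤ y := hY₀64.trans htY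
  have hy'64 : (64 : ℝ) ≤ y' := hY₀64.trans htY'
  set m₁ : ℕ := ⌊t ^ α⌋₊ with hm₁
  set n₁ : ℕ := ⌊y⌋₊ with hn₁
  set m₂ : ℕ := ⌊y' / 8⌋₊ with hm₂
  set n₂ : ℕ := ⌊y'⌋₊ with hn₂
  have hm₁' : t ^ α < (m₁ : ℝ) + 1 := Nat.lt_floor_add_one _
  have hm₁le : (m₁ : ℝ) ≤ t ^ α := Nat.floor_le htα.le
  have hn₁le : (n₁ : ℝ) ≤ y := Nat.floor_le (by positivity)
  have hn₂le : (n₂ : ℝ) ≤ y' := Nat.floor_le (by positivity)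
  have hm₂' : y' / 8 < (m₂ : ℝ) + 1 := Nat.lt_floor_add_one _
  have hn₁1 : (1 : ℝ) ≤ n₁ := by
    have : (1 : ℕ) ≤ n₁ := Nat.le_floor (by norm_num; linarith)
    exact_mod_cast this
  have hn₂1 : (1 : ℝ) ≤ n₂ := by
    have : (1 : ℕ) ≤ n₂ := Nat.le_floor (by norm_num; linarith)
    exact_mod_cast this
  -- hypotheses of the pair count
  have hc1 : 4 ≤ m₁ := Nat.le_floor (by norm_num; exact ht4)
  have hc2 : 4 ≤ m₂ := Nat.le_floor (by norm_num; linarith)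
  have hcE : 16 * n₁ ^ 4 < (m₂ + 1) ^ E := by
    have h1 : (16 : ℝ) * (n₁ : ℝ) ^ 4 ≤ (2 : ℝ) ^ 16 * t ^ (4 * α) := by
      have e : t ^ (4 * α) = (t ^ α) ^ 4 := by
        rw [show (4 : ℝ) * α = α * 4 by ring, Real.rpow_mul ht0.le]; norm_num
      rw [e]
      calc (16 : ℝ) * (n₁ : ℝ) ^ 4 ≤ 16 * (8 * t ^ α) ^ 4 := by gcongr
        _ = (2 : ℝ) ^ 16 * (t ^ α) ^ 4 := by ring
    have h2 : (2 : ℝ) ^ 16 * t ^ (4 * α) ≤ (y' / 8) ^ E := by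
      have e1 : (y' / 8) ^ E = (cD / 8) ^ E * (t ^ β) ^ E := by rw [hy']; ring
      have e2 : (t ^ β) ^ E = t ^ (β * E) := by
        rw [← Real.rpow_natCast, ← Real.rpow_mul ht0.le]
      have e3 : t ^ (β * E) = t ^ (β * E - 4 * α) * t ^ (4 * α) := by
        rw [← Real.rpow_add ht0]; congr 1; ring
      rw [e1, e2, e3]
      have h8 : (0 : ℝ) < (cD / 8) ^ E := by positivity
      have : (2 : ℝ) ^ 16 ≤ (cD / 8) ^ E * t ^ (β * E - 4 * α) := by
        have h := mul_le_mul_of_nonneg_left htE h8.le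
        have e4 : (cD / 8) ^ E * ((2 : ℝ) ^ 16 * (8 / cD) ^ E) = 2 ^ 16 := by
          rw [show (cD / 8) ^ E * ((2 : ℝ) ^ 16 * (8 / cD) ^ E) = 2 ^ 16 * ((cD / 8) * (8 / cD)) ^ E by
            rw [mul_pow]; ring]
          rw [show (cD / 8) * (8 / cD) = (1 : ℝ) by field_simp, one_pow, mul_one]
        linarith
      have ht4α : (0 : ℝ) ≤ t ^ (4 * α) := (Real.rpow_pos_of_pos ht0 _).le
      calc (2 : ℝ) ^ 16 * t ^ (4 * α) ≤ ((cD / 8) ^ E * t ^ (β * E - 4 * α)) * t ^ (4 * α) :=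
            mul_le_mul_of_nonneg_right this ht4α
        _ = (cD / 8) ^ E * (t ^ (β * E - 4 * α) * t ^ (4 * α)) := by ring
    have h3 : (y' / 8) ^ E < ((m₂ : ℝ) + 1) ^ E :=
      pow_lt_pow_left₀ hm₂' (by positivity) (by omega)
    have : ((16 * n₁ ^ 4 : ℕ) : ℝ) < (((m₂ + 1) ^ E : ℕ) : ℝ) := by
      push_cast
      linarith
    exact_mod_cast this
  have hc3 : (n₂ : ℝ) ^ (2 * κ - 6) ≤ (2 : ℝ) ^ (23 - 13 * κ) * ((m₁ : ℝ) + 1) ^ (12 - 3 * κ) := by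
    rw [← hα, ← hβ, ← hcDα]
    calc (n₂ : ℝ) ^ α ≤ y' ^ α := Real.rpow_le_rpow (by positivity) hn₂le hα0.le
      _ = cD ^ α * (t ^ α) ^ β := by
          rw [hy', Real.mul_rpow hcD0.le htβ.le, ← Real.rpow_mul ht0.le, ← Real.rpow_mul ht0.le,
            mul_comm β α]
      _ ≤ cD ^ α * ((m₁ : ℝ) + 1) ^ β :=
          mul_le_mul_of_nonneg_left (Real.rpow_le_rpow htα.le hm₁'.le hβ0.le) (by positivity)
  -- NEW: the upper edge on the ranges
  have hup : ∀ p d : ℕ, m₁ + 1 ≤ p → p ≤ n₁ → m₂ + 1 ≤ d → d ≤ n₂ →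
      (2 : ℝ) ^ 24 * (p : ℝ) ^ 12 * (d : ℝ) ^ 6 ≤ ((p : ℝ) * (d : ℝ) ^ 2) ^ σ := by
    intro p d hpm hpn hdm hdn
    have hp0 : (0 : ℝ) < p := by exact_mod_cast (show 0 < p by omega)
    have hd0 : (0 : ℝ) < d := by exact_mod_cast (show 0 < d by omega)
    have hpy : (p : ℝ) ≤ y := le_trans (by exact_mod_cast hpn) hn₁le
    have hzd : y' / 8 ≤ d := by
      have : ((m₂ : ℝ) + 1) ≤ d := by exact_mod_cast hdm
      linarith
    have hz0 : 0 < y' / 8 := by positivity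
    have hps : (p : ℝ) ^ s ≤ y ^ s := Real.rpow_le_rpow hp0.le hpy hs0
    have hys : y ^ s = (8 : ℝ) ^ s * t ^ (α * s) := by
      rw [hy, Real.mul_rpow (by norm_num) htα.le, ← Real.rpow_mul ht0.le]
    have hdr : (y' / 8) ^ r ≤ (d : ℝ) ^ r := Real.rpow_le_rpow hz0.le hzd hr0.le
    have hzr : (y' / 8) ^ r = B * t ^ (β * r) := by
      rw [hy', show cD * t ^ β / 8 = (cD / 8) * t ^ β by ring,
        Real.mul_rpow (by positivity) htβ.le, ← Real.rpow_mul ht0.le]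
    have hAB : A ≤ t ^ γ * B := (div_le_iff₀ hB0).mp htAB
    have hγs : t ^ γ * t ^ (α * s) = t ^ (β * r) := by
      rw [← Real.rpow_add ht0]; congr 1; rw [hγ]; ring
    have key : (2 : ℝ) ^ 24 * (p : ℝ) ^ s ≤ (d : ℝ) ^ r :=
      calc (2 : ℝ) ^ 24 * (p : ℝ) ^ s ≤ (2 : ℝ) ^ 24 * y ^ s := by gcongr
        _ = A * t ^ (α * s) := by rw [hys, hA]; ring
        _ ≤ (t ^ γ * B) * t ^ (α * s) :=
            mul_le_mul_of_nonneg_right hAB (Real.rpow_pos_of_pos ht0 _).le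
        _ = B * (t ^ γ * t ^ (α * s)) := by ring
        _ = (y' / 8) ^ r := by rw [hγs, hzr]
        _ ≤ (d : ℝ) ^ r := hdr
    exact upper_edge_of_rpow_le hp0 hd0 key
  set X : ℝ := (2 : ℝ) ^ 13 * (n₁ : ℝ) ^ 3 * (n₂ : ℝ) ^ 2 with hX
  have hX1 : 1 ≤ X := by
    rw [hX]
    have h1 : (1 : ℝ) ≤ (n₁ : ℝ) ^ 3 := one_le_pow₀ hn₁1
    have h2 : (1 : ℝ) ≤ (n₂ : ℝ) ^ 2 := one_le_pow₀ hn₂1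
    nlinarith
  have hpc := card_pairs_le_windowCount_of_edges hκ3 hκ4 hσ0 hc1 hc2 hcE hc3 hup (le_refl X)
  -- (1) lower bounds for the two prime counts
  have hm₁n₁ : m₁ ≤ n₁ := Nat.floor_le_floor (by rw [hy]; linarith)
  have hm₂n₂ : m₂ ≤ n₂ := Nat.floor_le_floor (by linarith [hy'64])
  have hP : y / (8 * Real.log y) ≤ (((Finset.Ioc m₁ n₁).filter Nat.Prime).card : ℝ) := by
    rw [card_primes_Ioc hm₁n₁, Nat.cast_sub (Nat.monotone_primeCounting hm₁n₁)]
    have := hsupply y htY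
    rwa [show y / 8 = t ^ α by rw [hy]; ring] at this
  have hD : y' / (8 * Real.log y') ≤ (((Finset.Ioc m₂ n₂).filter Nat.Prime).card : ℝ) := by
    rw [card_primes_Ioc hm₂n₂, Nat.cast_sub (Nat.monotone_primeCounting hm₂n₂)]
    exact hsupply y' htY'
  have hlogy : 0 < Real.log y := Real.log_pos (by linarith)
  have hlogy' : 0 < Real.log y' := Real.log_pos (by linarith)
  have hlogt : 0 < Real.log t := Real.log_pos (by linarith)
  have hlogyle : Real.log y ≤ (α + 1) * Real.log t := by
    rw [hy, Real.log_mul (by norm_num) htα.ne', Real.log_rpow ht0]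
    have : Real.log 8 ≤ Real.log t := Real.log_le_log (by norm_num) ht8
    linarith
  have hlogy'le : Real.log y' ≤ (β + 1) * Real.log t := by
    rw [hy', Real.log_mul hcD0.ne' htβ.ne', Real.log_rpow ht0]
    have : Real.log cD ≤ Real.log t := Real.log_le_log hcD0 htcD
    linarith
  -- the exclusions cost at most half of the `d`-range: `E ≤ y'/(16 log y')`
  have hEsmall : (E : ℝ) ≤ y' / (16 * Real.log y') := by
    have h1 : Real.log t ≤ c₂ * t ^ β := by
      have := hlogbd'
      rwa [Real.norm_of_nonneg hlogt.le, Real.norm_of_nonneg htβ.le] at this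
    rw [le_div_iff₀ (by positivity)]
    calc (E : ℝ) * (16 * Real.log y') ≤ E * (16 * ((β + 1) * Real.log t)) := by gcongr
      _ ≤ E * (16 * ((β + 1) * (c₂ * t ^ β))) := by gcongr
      _ = y' := by rw [hc₂, hy']; field_simp
  have hD' : y' / (16 * Real.log y') ≤
      ((((Finset.Ioc m₂ n₂).filter Nat.Prime).card - E : ℕ) : ℝ) := by
    have hED : E ≤ ((Finset.Ioc m₂ n₂).filter Nat.Prime).card := by
      have h2 : y' / (16 * Real.log y') ≤ y' / (8 * Real.log y') :=
        div_le_div_of_nonneg_left (by positivity) (by positivity) (by linarith)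
      have : (E : ℝ) ≤ (((Finset.Ioc m₂ n₂).filter Nat.Prime).card : ℝ) := hEsmall.trans (h2.trans hD)
      exact_mod_cast this
    rw [Nat.cast_sub hED]
    have e : y' / (8 * Real.log y') = y' / (16 * Real.log y') + y' / (16 * Real.log y') := by
      field_simp; ring
    linarith
  -- (2) upper bound from the hypothesised saving
  have hXle : X ≤ (2 : ℝ) ^ 22 * cD ^ 2 * t ^ (6 : ℝ) := by
    have e : t ^ (6 : ℝ) = (t ^ α) ^ 3 * (t ^ β) ^ 2 := by
      have e1 : (t ^ α) ^ 3 = t ^ (α * 3) := by rw [Real.rpow_mul ht0.le]; norm_num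
      have e2 : (t ^ β) ^ 2 = t ^ (β * 2) := by rw [Real.rpow_mul ht0.le]; norm_num
      rw [e1, e2, ← Real.rpow_add ht0]
      congr 1
      linarith
    rw [hX, e]
    have h1 : (n₁ : ℝ) ^ 3 ≤ (8 * t ^ α) ^ 3 := pow_le_pow_left₀ (by positivity) hn₁le 3
    have h2 : (n₂ : ℝ) ^ 2 ≤ (cD * t ^ β) ^ 2 := pow_le_pow_left₀ (by positivity) hn₂le 2
    calc (2 : ℝ) ^ 13 * (n₁ : ℝ) ^ 3 * (n₂ : ℝ) ^ 2 ≤ (2 : ℝ) ^ 13 * (8 * t ^ α) ^ 3 * (cD * t ^ β) ^ 2 := by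
          gcongr
      _ = (2 : ℝ) ^ 22 * cD ^ 2 * ((t ^ α) ^ 3 * (t ^ β) ^ 2) := by ring
  have hup2 : (windowCount κ σ X : ℝ) ≤ C₂ * t ^ (6 * δ') := by
    have hXδ : X ^ δ ≤ X ^ δ' := Real.rpow_le_rpow_of_exponent_le hX1 (le_max_left _ _)
    have hXδ' : X ^ δ' ≤ ((2 : ℝ) ^ 22 * cD ^ 2) ^ δ' * t ^ (6 * δ') := by
      calc X ^ δ' ≤ ((2 : ℝ) ^ 22 * cD ^ 2 * t ^ (6 : ℝ)) ^ δ' :=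
            Real.rpow_le_rpow (by positivity) hXle hδ'0
        _ = ((2 : ℝ) ^ 22 * cD ^ 2) ^ δ' * t ^ (6 * δ') := by
            rw [Real.mul_rpow (by positivity) (by positivity), ← Real.rpow_mul ht0.le]
    calc (windowCount κ σ X : ℝ) ≤ C * X ^ δ := hcount X hX1
      _ ≤ max C 0 * X ^ δ := by gcongr; exact le_max_left _ _
      _ ≤ max C 0 * X ^ δ' := mul_le_mul_of_nonneg_left hXδ (le_max_right _ _)
      _ ≤ max C 0 * (((2 : ℝ) ^ 22 * cD ^ 2) ^ δ' * t ^ (6 * δ')) :=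
          mul_le_mul_of_nonneg_left hXδ' (le_max_right _ _)
      _ = C₂ * t ^ (6 * δ') := by rw [hC₂]; ring
  -- (3) combine: `y y' ≤ (8 log y)(16 log y') · C₂ t^{6δ'}`
  have hprod : y * y' ≤ (8 * Real.log y) * (16 * Real.log y') * (C₂ * t ^ (6 * δ')) := by
    have h1 : y / (8 * Real.log y) * (y' / (16 * Real.log y')) ≤ C₂ * t ^ (6 * δ') := by
      calc y / (8 * Real.log y) * (y' / (16 * Real.log y'))
          ≤ (((Finset.Ioc m₁ n₁).filter Nat.Prime).card : ℝ) *
              ((((Finset.Ioc m₂ n₂).filter Nat.Prime).card - E : ℕ) : ℝ) :=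
            mul_le_mul hP hD' (by positivity) (by positivity)
        _ ≤ (windowCount κ σ X : ℝ) := by exact_mod_cast hpc
        _ ≤ C₂ * t ^ (6 * δ') := hup2
    rw [div_mul_div_comm, div_le_iff₀ (by positivity)] at h1
    linarith
  -- (4) sizes: `y y' = 8 c_D t^{6−κ}`, `log y log y' ≤ (α+1)(β+1) log² t`, `log² t ≤ c₁ t^η`
  have hyy' : y * y' = 8 * cD * t ^ (6 - κ) := by
    rw [hy, hy', ← hαβ, Real.rpow_add ht0]; ring
  have hlog2 : Real.log t ^ 2 ≤ c₁ * t ^ η := by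
    have h1 : Real.log t ≤ c₁ * t ^ (η / 2) := by
      have := hlogbd
      rwa [Real.norm_of_nonneg hlogt.le, Real.norm_of_nonneg (Real.rpow_pos_of_pos ht0 _).le] at this
    have h2 : Real.log t ^ 2 ≤ (c₁ * t ^ (η / 2)) ^ 2 := pow_le_pow_left₀ hlogt.le h1 2
    have h3 : (t ^ (η / 2)) ^ 2 = t ^ η := by
      rw [← Real.rpow_natCast, ← Real.rpow_mul ht0.le]; congr 1; push_cast; ring
    calc Real.log t ^ 2 ≤ c₁ ^ 2 * (t ^ (η / 2)) ^ 2 := by rw [← mul_pow]; exact h2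
      _ ≤ c₁ * (t ^ (η / 2)) ^ 2 := by
          gcongr
          calc c₁ ^ 2 = c₁ * c₁ := sq c₁
            _ ≤ c₁ * 1 := mul_le_mul_of_nonneg_left hc₁1 hc₁0.le
            _ = c₁ := mul_one _
      _ = c₁ * t ^ η := by rw [h3]
  -- (5) the contradiction
  have htη : t ^ (6 * δ') * t ^ η = t ^ (6 - κ) := by
    rw [← Real.rpow_add ht0]; congr 1; rw [hη]; ring
  have ht6κ : (0 : ℝ) < t ^ (6 - κ) := Real.rpow_pos_of_pos ht0 _
  have hmain : 8 * cD * t ^ (6 - κ) ≤ 4 * cD * t ^ (6 - κ) * (C₂ / (C₂ + 1)) := by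
    calc 8 * cD * t ^ (6 - κ) = y * y' := hyy'.symm
      _ ≤ (8 * Real.log y) * (16 * Real.log y') * (C₂ * t ^ (6 * δ')) := hprod
      _ ≤ (8 * ((α + 1) * Real.log t)) * (16 * ((β + 1) * Real.log t)) * (C₂ * t ^ (6 * δ')) := by
          gcongr
      _ = 128 * (α + 1) * (β + 1) * C₂ * t ^ (6 * δ') * Real.log t ^ 2 := by ring
      _ ≤ 128 * (α + 1) * (β + 1) * C₂ * t ^ (6 * δ') * (c₁ * t ^ η) := by gcongr
      _ ≤ 128 * (α + 1) * (β + 1) * C₂ * t ^ (6 * δ') * (cD / K * t ^ η) := by gcongr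
      _ = 4 * cD * (t ^ (6 * δ') * t ^ η) * (C₂ * (32 * (α + 1) * (β + 1)) / K) := by ring
      _ = 4 * cD * t ^ (6 - κ) * (C₂ / (C₂ + 1)) := by
          rw [htη, hK]
          congr 1
          field_simp
  have hfrac : C₂ / (C₂ + 1) < 1 := by rw [div_lt_one (by positivity)]; linarith
  have : 4 * cD * t ^ (6 - κ) * (C₂ / (C₂ + 1)) < 8 * cD * t ^ (6 - κ) := by
    have hpos : 0 < 4 * cD * t ^ (6 - κ) := by positivity
    nlinarith
  linarith

/-- **Lower law for every `σ > 3` (unconditional) — refuted strengthening.**  For `3 < κ < 4`,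
`3 < σ`, `κ(2σ+3) < 9σ` there is no saving `δ < 1 − κ/6` in the window `[κ, σ]` (cases: `σ ≤ 12`
above; `σ > 12` is the landed `not_windowSaving_below_law`, where `κ(2σ+3) < 9σ` is automatic for
`κ < 4`).  This supersedes `not_windowSaving_below_law`. -/
theorem not_windowSaving_below_law' :
    ¬ ∃ κ σ δ C : ℝ, 3 < κ ∧ κ < 4 ∧ 3 < σ ∧ κ * (2 * σ + 3) < 9 * σ ∧ δ < 1 - κ / 6 ∧
        ∀ X : ℝ, 1 ≤ X → (windowCount κ σ X : ℝ) ≤ C * X ^ δ := by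
  rintro ⟨κ, σ, δ, C, hκ3, hκ4, hσ3, hκσ, hδ, hcount⟩
  rcases le_or_gt σ 12 with hσ12 | hσ12
  · exact not_windowSaving_below_law_of_sigma_le_twelve ⟨κ, σ, δ, C, hκ3, hσ3, hσ12, hκσ, hδ, hcount⟩
  · exact not_windowSaving_below_law ⟨κ, σ, δ, C, hκ3, hκ4, hσ12, hδ, hcount⟩

/-- For `3 < κ < σ ≤ 6` the crux's threshold is at most the law:
`(σ − κ)/(2σ − 6) ≤ 1 − κ/6` (the margin `(κ−3)(σ−6)/(3(2σ−6))` is `≤ 0`). -/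
theorem threshold_le_law_of_sigma_le_six {κ σ : ℝ} (hκ3 : 3 < κ) (hκσ : κ < σ) (hσ6 : σ ≤ 6) :
    (σ - κ) / (2 * σ - 6) ≤ 1 - κ / 6 := by
  have hden : 0 < 2 * σ - 6 := by linarith
  rw [div_le_iff₀ hden]
  nlinarith

/-- **No witness of the crux with `σ ≤ 6` below `κ = 9σ/(2σ+3)`** (unconditional):
`¬ ∃ κ σ δ C, 3 < κ < σ ≤ 6 ∧ κ(2σ+3) < 9σ ∧ δ < (σ−κ)/(2σ−6) ∧ ∀ X ≥ 1, T⁺_[κ,σ](X) ≤ C X^δ`.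
For `σ ≤ 6` the admissible savings `δ < (σ−κ)/(2σ−6) ≤ 1 − κ/6` are all defeated by the twisted Frey
family (`not_windowSaving_below_law_of_sigma_le_twelve`).  So a witness `(κ, σ, δ, C)` of
`SomeWindowSaving` has `σ > 6` or `κ ≥ 9σ/(2σ+3)` (`= 3.6` at `σ = 6`, `45/13` at `σ = 5`,
`36/11` at `σ = 4`; `→ 3` as `σ → 3⁺`). -/
theorem no_witness_of_sigma_le_six :
    ¬ ∃ κ σ δ C : ℝ, 3 < κ ∧ κ < σ ∧ σ ≤ 6 ∧ κ * (2 * σ + 3) < 9 * σ ∧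
        δ < (σ - κ) / (2 * σ - 6) ∧
        ∀ X : ℝ, 1 ≤ X → (windowCount κ σ X : ℝ) ≤ C * X ^ δ := by
  rintro ⟨κ, σ, δ, C, hκ3, hκσ, hσ6, hκσ', hδ, hcount⟩
  exact not_windowSaving_below_law_of_sigma_le_twelve ⟨κ, σ, δ, C, hκ3, by linarith, by linarith,
    hκσ', hδ.trans_le (threshold_le_law_of_sigma_le_six hκ3 hκσ hσ6), hcount⟩

/-- The same, phrased on the crux's own set-builder (`someWindowSaving_iff` is `Iff.rfl`): the
conjunction of `SomeWindowSaving`'s matrix with `σ ≤ 6 ∧ κ(2σ+3) < 9σ` is unsatisfiable. -/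
theorem someWindowSaving_false_with_sigma_le_six :
    ¬ ∃ κ σ δ C : ℝ, (σ ≤ 6 ∧ κ * (2 * σ + 3) < 9 * σ) ∧ 3 < κ ∧ κ < σ ∧
        δ < (σ - κ) / (2 * σ - 6) ∧
        ∀ X : ℝ, 1 ≤ X → (windowCount κ σ X : ℝ) ≤ C * X ^ δ := by
  rintro ⟨κ, σ, δ, C, ⟨hσ6, hκσ'⟩, hκ3, hκσ, hδ, hcount⟩
  exact no_witness_of_sigma_le_six ⟨κ, σ, δ, C, hκ3, hκσ, hσ6, hκσ', hδ, hcount⟩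

end SmallSigma

end Summit.ABC.ABC.Theorems.SomeWindowSaving.Negative
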